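import Mathlib.RepresentationTheory.Homological.ContCohomology.Basic
import Mathlib.RepresentationTheory.Homological.ContCohomology.Functoriality
import Mathlib.RepresentationTheory.Homological.ContCohomology.LowDegree
import Mathlib.RepresentationTheory.Continuous.Basic
import Mathlib.RingTheory.RootsOfUnity.Basic
import Mathlib.RingTheory.RootsOfUnity.AlgebraicallyClosed
import Mathlib.FieldTheory.KrullTopology
import Mathlib.FieldTheory.Galois.Profinite
import Mathlib.Algebra.Module.ZMod
import Mathlib.Topology.Algebra.Group.Quotient
import Mathlib.Topology.Instances.ZMod
import Literature.NumberTheory.GaloisRepresentations.AbsGaloisGroup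
import Literature.NumberTheory.GaloisRepresentations.ContinuousRep
import Literature.NumberTheory.GaloisRepresentations.GaloisRep
import HarnessLib

-- provenance: harness21/H21/H21/Prelude/GalRep/GaloisCohomology.lean @ f1218b6 (interim HEAD d8f2665); M5 mechanical rewrite
/-!
# Discrete Galois modules and Galois cohomology (GalRep trunk, item C13 = `G09:GaloisCohomology`)

Notion `galois_cohomology_discrete_module` (part 1): discrete `Γ_K`-modules and their
(continuous-cochain) cohomology `Hⁿ(K, M)`, entirely on top of Mathlib's continuous cohomology
of topological representations (`continuousCohomology`, `ContinuousCohomology.map`,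
`ContinuousCohomology.zeroIso`, `TopRep`).

## Main definitions

* `Literature.NumberTheory.GaloisRepresentations.ContinuousRep.ofStabilizerMemNhdsOne`: a representation on a *discrete* module is
  jointly continuous as soon as all stabilisers are neighbourhoods of `1` (real proof); converse
  `Literature.NumberTheory.GaloisRepresentations.ContinuousRep.isOpen_setOf_apply_eq`. `Literature.NumberTheory.GaloisRepresentations.ContinuousRep.subrepresentation`.
* `Literature.DiscreteGaloisModule K M := GaloisRep K ℤ M` for `[DiscreteTopology M]`, with constructor
  `DiscreteGaloisModule.ofIsOpenStabilizer` and `DiscreteGaloisModule.toTopRep`.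
* `Literature.galoisCohomology ρ n := continuousCohomology n ρ.toTopRep` (carrier, `AddCommGroup`),
  `Literature.galoisCohomologyZeroEquiv : H⁰(K, M) ≃+ M^{Γ_K}`,
  `Literature.NumberTheory.GaloisRepresentations.galoisCohomology.map` (functoriality in `M` along a Mathlib `ContIntertwiningMap`, `→ⁱL`),
  `Literature.NumberTheory.GaloisRepresentations.galoisCohomology.pullback` (along any `Γ_L →ₜ* Γ_K`), `Literature.NumberTheory.GaloisRepresentations.galoisCohomology.res`
  (restriction to `Γ_L` along `Literature.absGaloisRestrict K L`), `Literature.NumberTheory.GaloisRepresentations.galoisCohomology.inf`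
  (inflation from `Γ_K ⧸ S` for a normal subgroup `S`, module `DiscreteGaloisModule.quotientInvariants`).
* Modules: `DiscreteGaloisModule.units K` (`K̄ˣ`, on `DiscreteGaloisModule.UnitsCarrier K`),
  `DiscreteGaloisModule.mu K n` (`μₙ(K̄)`, on `DiscreteGaloisModule.MuCarrier K n`),
  `DiscreteGaloisModule.torsionBy ρ n` (`M[n]`), `DiscreteGaloisModule.tateTwist ρ ℓ n` (`M(1)`
  for an `ℓⁿ`-torsion module, via `Literature.cyclotomicCharacterModPow K ℓ n = χ_ℓ mod ℓⁿ`, built from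
  `Literature.NumberTheory.GaloisRepresentations.GaloisRep.cyclotomicCharacter` and `PadicInt.toZModPow`; `Literature.NumberTheory.GaloisRepresentations.PadicInt.continuous_toZModPow`).
  All continuity proofs are real: stabilisers contain `Gal(K̄/K(x))`
  (`Literature.NumberTheory.GaloisRepresentations.setOf_smul_eq_mem_nhds_one`, from `IntermediateField.fixingSubgroup_isOpen`).
* `Literature.absGaloisFixingSubgroup E = Gal(K̄/E) ⊴ Γ_K` for a normal subextension `E ⊆ K̄`;
  `Literature.ContinuousMonoidHom.quotientMk N : G →ₜ* G ⧸ N` (generic, missing from Mathlib).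

## Main statements — named facts

The following are vendored as **named facts** (`def X : Prop`, with the field `K` — and the
coefficient module `M` where present — explicit; consumers take `(h : X K)` / `(h : X K M)` as a
hypothesis), not theorems:

* `Literature.NumberTheory.GaloisRepresentations.subsingleton_galoisCohomology_units_one`: Hilbert 90, `H¹(K, K̄ˣ) = 0`.
* `Literature.NumberTheory.GaloisRepresentations.nonempty_addEquiv_galoisCohomology_mu_one`: Kummer, `H¹(K, μₙ) ≃+ Kˣ/(Kˣ)ⁿ`
  (the group `K/n` underlying Mathlib's `IsDedekindDomain.selmerGroup`).
* `Literature.NumberTheory.GaloisRepresentations.galoisCohomology.inf_one_injective`, `Literature.NumberTheory.GaloisRepresentations.exact_inf_res`: inflation–restriction in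
  degree one; `Literature.NumberTheory.GaloisRepresentations.galoisCohomology.exists_inf_eq_one`: every class in `H¹(K, M)` is inflated
  from a finite Galois `E/K` (`H¹(K, M) = lim→ H¹(Gal(E/K), M^{Γ_E})`, the comparison with
  finite-level `groupCohomology.H1`).
The transitivity of restriction `Literature.NumberTheory.GaloisRepresentations.galoisCohomology.res_comp` is a theorem (Mathlib
`ContinuousCohomology.map_comp`).  Cross-reference: `Literature/NumberTheory/EllipticCurves/
GaloisAction.lean` packages `continuousCohomology 1` of a discrete module as `Literature.discreteH1 G M`
(any topological group, degree one, no continuity of the action required); the present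
`galoisCohomology ρ n` is the faithful notion in all degrees, and the two should eventually be
unified.

## Mathlib declarations used rather than redefined

`Field.absoluteGaloisGroup`, `continuousCohomology`, `ContinuousCohomology.map`/`map_comp`/
`zeroIso`, `TopRep.of`/`ofHom`/`res`, `ContRepresentation`, `ContIntertwiningMap`,
`Representation.ofMulDistribMulAction`, `Representation.subrepresentation`,
`Representation.toInvariants`, `Representation.ofQuotient`, `Submodule.torsionBy`,
`rootsOfUnity`, `Units.mulDistribMulActionRight`, `PadicInt.toZModPow`,
`AlgEquiv.restrictNormalHom`, `IntermediateField.fixingSubgroup_isOpen`, `QuotientGroup.mk'`.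
Mathlib has no `H¹` of a profinite group with discrete coefficients other than through
`continuousCohomology`; the finite Hilbert 90 is `groupCohomology.H1ofAutOnUnitsUnique`.

## Design notes

* **Universes.** `DiscreteGaloisModule K M` and the module constructions allow `M : Type w`;
  `galoisCohomology` requires `M : Type u` (the universe of `K`, hence of `Γ_K`), because
  Mathlib's standard resolution `X ↦ C(Γ_K, X)` (`TopRep.coind₁`) must stay inside `TopRep.{u}`.
  Likewise `res`/`pullback` need `L : Type u` (`ContinuousCohomology.map` has `G H : Type v`).
* **Instances added.** `MulDistribMulAction Γ_K K̄ˣ` (Mathlib's reducible non-instance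
  `Units.mulDistribMulActionRight`) and `MulDistribMulAction Γ_K (rootsOfUnity n K̄)`; neither
  overrides an existing instance. No topology is put on `(AlgebraicClosure K)ˣ` itself (Mathlib
  topologises `AlgebraicClosure ℚ_[p] = PadicAlgCl p` as a normed field, so a global discrete
  instance would create a diamond): the modules `units K`, `mu K n` live on the H21 type
  synonyms `DiscreteGaloisModule.UnitsCarrier K = Additive K̄ˣ`,
  `DiscreteGaloisModule.MuCarrier K n = Additive (rootsOfUnity n K̄)` with the discrete topology.
* **`res_comp`.** In a tower `E/L/K` the modules `(ρ|_L)|_E` and `ρ|_E` differ (the chosen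
  embeddings `K̄ → L̄ → Ē` and `K̄ → Ē` differ by conjugation), so transitivity is stated against
  `pullback` along the composite `Γ_E → Γ_L → Γ_K`, which typechecks by
  `ContinuousRep.restrict_comp` (`rfl`).
* **Inflation–restriction** is phrased for a normal intermediate field `E ⊆ K̄`, with
  `Γ_K ⧸ Gal(K̄/E)` (topological quotient) in place of `Gal(E/K)`; the image of
  `absGaloisRestrict K E` is `Gal(K̄/E)` since `E/K` is normal, so the statement is
  independent of the choice in `absGaloisRestrict`.
* `mu K n` does not assume `[NeZero (n : K)]` (unused by the definition); the Kummer statement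
  does.

## References

* J.-P. Serre, *Galois Cohomology* (1997), Ch. I §2, Ch. II §1.
* J. Neukirch, A. Schmidt, K. Wingberg, *Cohomology of Number Fields* (2008), Ch. I §§1.1–1.6.
* J. S. Milne, *Arithmetic Duality Theorems* (2006), Ch. I §0.
* J.-P. Serre, *Abelian ℓ-adic representations and elliptic curves* (1968), Ch. I §1.2.
-/

noncomputable section

open CategoryTheory Field Topology
open scoped ContRepresentation

namespace Literature.NumberTheory.GaloisRepresentations

universe u w

/-! ### Continuous representations on discrete modules -/

namespace ContinuousRep

section Discrete

variable {G : Type u} [Group G] [TopologicalSpace G]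
  {A : Type*} [CommRing A] [TopologicalSpace A]
  {M : Type w} [AddCommGroup M] [Module A M] [TopologicalSpace M] [DiscreteTopology M]

section ContinuousMul

variable [ContinuousMul G]

/-- A representation of a topological group `G` on a *discrete* module `M` is (jointly)
continuous as soon as every stabiliser `{σ | ρ σ m = m}` is a neighbourhood of `1`; this is the
usual definition of a *discrete `G`-module* (Serre, *Galois Cohomology* (1997), Ch. I §2.1;
Neukirch–Schmidt–Wingberg, *Cohomology of Number Fields*, (1.1.8)). Proof: `G × M` is a
disjoint union of copies of `G` (`continuous_prod_of_discrete_right`), and the fibre of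
`σ ↦ ρ σ m` over `b = ρ σ₀ m` contains the translate `σ₀ • Stab(m)`. [folklore] -/
def ofStabilizerMemNhdsOne (ρ : Representation A G M)
    (h : ∀ m : M, {σ : G | ρ σ m = m} ∈ 𝓝 (1 : G)) : ContinuousRep G A M where
  toRepresentation := ρ
  continuous_smul := by
    refine continuous_prod_of_discrete_right.2 fun m => continuous_discrete_rng.2 fun b => ?_
    refine isOpen_iff_mem_nhds.2 fun σ₀ hσ₀ => ?_
    have hc : Continuous fun τ : G => σ₀⁻¹ * τ := continuous_const.mul continuous_id
    have h1 : (fun τ : G => σ₀⁻¹ * τ) ⁻¹' {σ : G | ρ σ m = m} ∈ 𝓝 σ₀ := by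
      refine hc.continuousAt.preimage_mem_nhds ?_
      simpa only [inv_mul_cancel] using h m
    refine Filter.mem_of_superset h1 fun τ hτ => ?_
    simp only [Set.mem_preimage, Set.mem_singleton_iff, Set.mem_setOf_eq] at hσ₀ hτ ⊢
    have := congr(ρ σ₀ $hτ)
    rwa [← Module.End.mul_apply, ← map_mul, mul_inv_cancel_left, hσ₀] at this

/-- Unfolding lemma for `ofStabilizerMemNhdsOne`. [folklore] -/
@[simp] lemma ofStabilizerMemNhdsOne_apply (ρ : Representation A G M)
    (h : ∀ m : M, {σ : G | ρ σ m = m} ∈ 𝓝 (1 : G)) (g : G) :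
    ofStabilizerMemNhdsOne ρ h g = ρ g := rfl

end ContinuousMul

/-- Conversely, for a continuous representation on a discrete module every stabiliser
`{σ | ρ σ m = m}` is an open subset of `G` (Serre, *Galois Cohomology*, Ch. I §2.1). [folklore] -/
theorem isOpen_setOf_apply_eq (ρ : ContinuousRep G A M) (m : M) :
    IsOpen {σ : G | ρ σ m = m} :=
  (isOpen_discrete {m}).preimage (ρ.continuous_apply_left m)

/-- For a continuous representation on a discrete module every stabiliser is a neighbourhood
of `1` (Serre, *Galois Cohomology*, Ch. I §2.1). [folklore] -/
theorem setOf_apply_eq_mem_nhds_one (ρ : ContinuousRep G A M) (m : M) :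
    {σ : G | ρ σ m = m} ∈ 𝓝 (1 : G) :=
  (ρ.isOpen_setOf_apply_eq m).mem_nhds (by simp)

end Discrete

section Sub

variable {G : Type u} [Group G] [TopologicalSpace G] {A : Type*} [CommRing A] [TopologicalSpace A]
  {M : Type w} [AddCommGroup M] [Module A M] [TopologicalSpace M]

/-- The continuous subrepresentation on a `G`-stable submodule `W ≤ M` (subspace topology);
the algebraic part is Mathlib's `Representation.subrepresentation`.
(Serre, *Linear representations of finite groups*, §1.3.) [folklore] -/
def subrepresentation (ρ : ContinuousRep G A M) (W : Submodule A M)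
    (h : ∀ g : G, W ≤ W.comap (ρ g)) : ContinuousRep G A W where
  toRepresentation := ρ.toRepresentation.subrepresentation W h
  continuous_smul :=
    (ρ.continuous_smul.comp
      (continuous_fst.prodMk (continuous_subtype_val.comp continuous_snd))).subtype_mk _

/-- Unfolding lemma for `ContinuousRep.subrepresentation`. [folklore] -/
@[simp] lemma subrepresentation_apply_coe (ρ : ContinuousRep G A M) (W : Submodule A M)
    (h : ∀ g : G, W ≤ W.comap (ρ g)) (g : G) (w : W) :
    (ρ.subrepresentation W h g w : M) = ρ g w := rfl

end Sub

end ContinuousRep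

/-! ### Discrete Galois modules -/

section DiscreteGaloisModule

/-- A **discrete Galois module** over the field `K`: an abelian group `M` carrying the discrete
topology together with a continuous `ℤ`-linear action of the absolute Galois group
`Γ_K = Field.absoluteGaloisGroup K` (Krull topology), i.e. an `Literature.GaloisRep K ℤ M`
(= `Literature.ContinuousRep (absoluteGaloisGroup K) ℤ M`) with `[DiscreteTopology M]`. Continuity
is then equivalent to openness of all stabilisers (`DiscreteGaloisModule.ofIsOpenStabilizer`,
`ContinuousRep.isOpen_setOf_apply_eq`).
Ref: Serre, *Galois Cohomology* (1997), Ch. I §2.1, Ch. II §1.1. [folklore] -/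
-- `[DiscreteTopology M]` is deliberately part of the signature (it is the defining hypothesis of
-- the notion and is consumed by every construction below), although the body does not use it.
@[nolint unusedArguments]
abbrev DiscreteGaloisModule (K : Type u) [Field K] (M : Type w) [AddCommGroup M]
    [TopologicalSpace M] [DiscreteTopology M] : Type (max u w) :=
  GaloisRep K ℤ M

namespace DiscreteGaloisModule

variable {K : Type u} [Field K] {M : Type w} [AddCommGroup M] [TopologicalSpace M]
  [DiscreteTopology M]

/-- Constructor for discrete Galois modules: a `ℤ`-linear representation of `Γ_K` on a
discrete abelian group all of whose stabilisers `{σ | ρ σ m = m}` are open is continuous.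
Ref: Serre, *Galois Cohomology* (1997), Ch. I §2.1 (definition of a discrete `G`-module). [folklore] -/
def ofIsOpenStabilizer (ρ : Representation ℤ (absoluteGaloisGroup K) M)
    (h : ∀ m : M, IsOpen {σ : absoluteGaloisGroup K | ρ σ m = m}) : DiscreteGaloisModule K M :=
  ContinuousRep.ofStabilizerMemNhdsOne ρ fun m => (h m).mem_nhds (by simp)

/-- Unfolding lemma for `ofIsOpenStabilizer`. [folklore] -/
@[simp] lemma ofIsOpenStabilizer_apply (ρ : Representation ℤ (absoluteGaloisGroup K) M)
    (h : ∀ m : M, IsOpen {σ : absoluteGaloisGroup K | ρ σ m = m}) (σ : absoluteGaloisGroup K) :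
    ofIsOpenStabilizer ρ h σ = ρ σ := rfl

/-- The object of Mathlib's category `TopRep ℤ Γ_K` attached to a discrete Galois module
(`Literature.NumberTheory.GaloisRepresentations.ContinuousRep.toTopRep`; the instances `IsTopologicalAddGroup M`, `ContinuousSMul ℤ M`
come from discreteness). This is the input of Mathlib's `continuousCohomology`.
Ref: Mathlib `RepresentationTheory/Continuous/TopRep.lean`. [folklore] -/
abbrev toTopRep (ρ : DiscreteGaloisModule K M) : TopRep.{w} ℤ (absoluteGaloisGroup K) :=
  ContinuousRep.toTopRep ρ

end DiscreteGaloisModule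

end DiscreteGaloisModule

/-! ### Galois cohomology -/

section Cohomology

variable {K : Type u} [Field K] {M : Type u} [AddCommGroup M] [TopologicalSpace M]
  [DiscreteTopology M] {N : Type u} [AddCommGroup N] [TopologicalSpace N] [DiscreteTopology N]

/-- The **Galois cohomology group** `Hⁿ(K, M) = Hⁿ(Γ_K, M)` of a discrete Galois module:
the continuous cohomology (homogeneous continuous cochains) of `Γ_K` with coefficients in `M`,
i.e. the carrier of Mathlib's `continuousCohomology n ρ.toTopRep : TopModuleCat ℤ`.
Universe restriction: `M` lives in the universe of `K` (Mathlib's standard resolution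
`C(Γ_K, C(Γ_K, … M))` must stay in one universe).
Ref: Serre, *Galois Cohomology* (1997), Ch. I §2.2, Ch. II §1.1;
Mathlib `RepresentationTheory/Homological/ContCohomology/Basic.lean`. [folklore] -/
def galoisCohomology (ρ : DiscreteGaloisModule K M) (n : ℕ) : Type u :=
  (continuousCohomology n ρ.toTopRep : TopModuleCat ℤ)

/-- `Hⁿ(K, M)` is an abelian group (structure transported from Mathlib's `TopModuleCat ℤ`
object). Ref: Serre, *Galois Cohomology* (1997), Ch. I §2.2. [folklore] -/
instance galoisCohomology.instAddCommGroup (ρ : DiscreteGaloisModule K M) (n : ℕ) :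
    AddCommGroup (galoisCohomology ρ n) :=
  inferInstanceAs <| AddCommGroup (continuousCohomology n ρ.toTopRep : TopModuleCat ℤ)

/-- The invariants of Mathlib's `ContRepresentation` underlying `ρ` are the invariants of `ρ`. [folklore] -/
lemma DiscreteGaloisModule.invariants_toContRepresentation (ρ : DiscreteGaloisModule K M) :
    ρ.toContRepresentation.invariants = ρ.invariants :=
  Submodule.ext fun _ => Iff.rfl

/-- `H⁰(K, M) ≃+ M^{Γ_K}`: degree-zero Galois cohomology is the group of invariants
(Mathlib `ContinuousCohomology.zeroIso`, transported to `Literature.NumberTheory.GaloisRepresentations.ContinuousRep.invariants`).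
Ref: Serre, *Galois Cohomology* (1997), Ch. I §2.2. [folklore] -/
def galoisCohomologyZeroEquiv (ρ : DiscreteGaloisModule K M) :
    galoisCohomology ρ 0 ≃+ ρ.invariants :=
  ((ContinuousCohomology.zeroIso ρ.toTopRep).toContinuousLinearEquiv.toLinearEquiv.trans
    (LinearEquiv.ofEq _ _ ρ.invariants_toContRepresentation)).toAddEquiv

namespace galoisCohomology

/-- Functoriality of `Hⁿ(K, –)` in the module: the map `Hⁿ(K, M) →+ Hⁿ(K, N)` induced by a
continuous `Γ_K`-equivariant map `f : M → N` (Mathlib `ContIntertwiningMap`, notation `→ⁱL`,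
between the underlying `ContRepresentation`s), through the induced morphism in `TopRep` and
`ContinuousCohomology.map (ContinuousMonoidHom.id _)`.
Ref: Serre, *Galois Cohomology* (1997), Ch. I §2.2. [folklore] -/
def map {ρ : DiscreteGaloisModule K M} {ρ' : DiscreteGaloisModule K N}
    (f : ρ.toContRepresentation →ⁱL ρ'.toContRepresentation) (n : ℕ) :
    galoisCohomology ρ n →+ galoisCohomology ρ' n :=
  (ContinuousCohomology.map (ContinuousMonoidHom.id (absoluteGaloisGroup K))
    (X := ρ.toTopRep) (Y := ρ'.toTopRep)
    (TopRep.ofHom ⟨f.toContinuousLinearMap, f.isIntertwining'⟩) n).hom.toLinearMap.toAddMonoidHom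

/-- Functoriality of `Hⁿ(–, M)` in the group: pull-back `Hⁿ(Γ_K, M) →+ Hⁿ(Γ_L, M)` along an
arbitrary continuous homomorphism `φ : Γ_L →ₜ* Γ_K`, with `Γ_L` acting on `M` through `φ`
(`Literature.NumberTheory.GaloisRepresentations.ContinuousRep.restrict`); Mathlib `ContinuousCohomology.map φ (𝟙 _)`.
The restriction map `galoisCohomology.res` is the case `φ = absGaloisRestrict K L`.
Ref: Serre, *Galois Cohomology* (1997), Ch. I §2.4. [folklore] -/
def pullback {L : Type u} [Field L] (ρ : DiscreteGaloisModule K M)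
    (φ : absoluteGaloisGroup L →ₜ* absoluteGaloisGroup K) (n : ℕ) :
    galoisCohomology ρ n →+ galoisCohomology (ContinuousRep.restrict ρ φ) n :=
  (ContinuousCohomology.map φ (X := ρ.toTopRep)
    (Y := DiscreteGaloisModule.toTopRep (ContinuousRep.restrict ρ φ))
    (TopRep.ofHom ⟨ContinuousLinearMap.id ℤ M, fun _ => rfl⟩) n).hom.toLinearMap.toAddMonoidHom

/-- The **restriction map** `res : Hⁿ(K, M) →+ Hⁿ(L, M)` for a field extension `L/K`, along
the continuous homomorphism `absGaloisRestrict K L : Γ_L →ₜ* Γ_K` (`Γ_L` acting on `M` via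
`GaloisRep.restrictField L ρ`).
Ref: Serre, *Galois Cohomology* (1997), Ch. I §2.4; Neukirch–Schmidt–Wingberg (1.5.0). [folklore] -/
def res (ρ : DiscreteGaloisModule K M) (L : Type u) [Field L] [Algebra K L] (n : ℕ) :
    galoisCohomology ρ n →+ galoisCohomology (ρ.restrictField L) n :=
  pullback ρ (absGaloisRestrict K L) n

/-- Transitivity of restriction in a tower `E/L/K` (`[IsScalarTower K L E]` is not even needed
for the statement): restricting from `K` to `L` and then to `E` is the pull-back along the
composite `Γ_E → Γ_L → Γ_K` (Mathlib `ContinuousCohomology.map_comp`; the two iterated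
restrictions of `ρ` agree definitionally).
Ref: Serre, *Galois Cohomology* (1997), Ch. I §2.4. [folklore] -/
theorem res_comp (ρ : DiscreteGaloisModule K M) (L : Type u) [Field L] [Algebra K L] (E : Type u)
    [Field E] [Algebra L E] (n : ℕ) :
    (res (ρ.restrictField L) E n).comp (res ρ L n) =
      pullback ρ ((absGaloisRestrict K L).comp (absGaloisRestrict L E)) n := by
  refine AddMonoidHom.ext fun x => ?_
  exact congrArg (fun T => TopModuleCat.Hom.hom T x)
    (ContinuousCohomology.map_comp (absGaloisRestrict K L) (absGaloisRestrict L E)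
      (X := ρ.toTopRep) (Y := DiscreteGaloisModule.toTopRep (ρ.restrictField L))
      (Z := DiscreteGaloisModule.toTopRep ((ρ.restrictField L).restrictField E))
      (TopRep.ofHom ⟨ContinuousLinearMap.id ℤ M, fun _ => rfl⟩)
      (TopRep.ofHom ⟨ContinuousLinearMap.id ℤ M, fun _ => rfl⟩) n).symm

end galoisCohomology

end Cohomology

/-! ### Stabilisers of the Galois action on `K̄` are open -/

section Stabilizer

variable (K : Type u) [Field K]

/-- For `x ∈ K̄` the stabiliser `{σ ∈ Γ_K | σ • x = x}` is a neighbourhood of `1` in the Krull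
topology: it contains the open subgroup `Gal(K̄/K(x))` (`IntermediateField.fixingSubgroup_isOpen`,
`K(x)/K` being finite as `x` is algebraic). This is the discreteness of `K̄` and `K̄ˣ` as
`Γ_K`-modules. Ref: Serre, *Galois Cohomology* (1997), Ch. II §1.1. [folklore] -/
theorem setOf_smul_eq_mem_nhds_one (x : AlgebraicClosure K) :
    {σ : absoluteGaloisGroup K | σ • x = x} ∈ 𝓝 (1 : absoluteGaloisGroup K) := by
  have hx : IsIntegral K x := Algebra.IsIntegral.isIntegral x
  haveI := IntermediateField.adjoin.finiteDimensional hx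
  refine Filter.mem_of_superset
    ((IntermediateField.fixingSubgroup_isOpen (IntermediateField.adjoin K {x})).mem_nhds
      (Subgroup.one_mem _)) fun σ hσ => ?_
  exact (IntermediateField.mem_fixingSubgroup_iff _ _).1 hσ x
    (IntermediateField.mem_adjoin_simple_self K x)

end Stabilizer

/-! ### The modules `K̄ˣ`, `μₙ`, torsion, Tate twists -/

/-- The action of `Γ_K` on the units `K̄ˣ` (restriction of the action on `K̄`;
Mathlib's reducible non-instance `Units.mulDistribMulActionRight`, which Mathlib does not
register globally only to avoid a diamond with `Units.mulAction'` in the commuting-scalar case,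
irrelevant for a Galois action). Placed in the `Field.absoluteGaloisGroup` namespace like the
other transported action instances of `AbsGaloisGroup.lean`.
Ref: Serre, *Galois Cohomology* (1997), Ch. II §1.2. [folklore] -/
instance _root_.Field.absoluteGaloisGroup.instMulDistribMulActionUnits (K : Type u) [Field K] :
    MulDistribMulAction (absoluteGaloisGroup K) (AlgebraicClosure K)ˣ :=
  Units.mulDistribMulActionRight

/-- The action of `Γ_K` on the `n`-th roots of unity `μₙ(K̄) = rootsOfUnity n K̄`
(a `Γ_K`-stable subgroup of `K̄ˣ`). Ref: Serre, *Galois Cohomology* (1997), Ch. II §1.2. [folklore] -/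
instance _root_.Field.absoluteGaloisGroup.instMulDistribMulActionRootsOfUnity (K : Type u)
    [Field K] (n : ℕ) :
    MulDistribMulAction (absoluteGaloisGroup K) (rootsOfUnity n (AlgebraicClosure K)) where
  smul σ ζ := ⟨σ • (ζ : (AlgebraicClosure K)ˣ), by
    rw [mem_rootsOfUnity, ← smul_pow', ζ.2, smul_one]⟩
  one_smul ζ := Subtype.ext (one_smul _ _)
  mul_smul σ τ ζ := Subtype.ext (mul_smul _ _ _)
  smul_mul σ ζ ζ' := Subtype.ext (smul_mul' _ _ _)
  smul_one σ := Subtype.ext (smul_one _)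

/-- Unfolding lemma for the action on roots of unity. [folklore] -/
@[simp] lemma _root_.Field.absoluteGaloisGroup.coe_smul_rootsOfUnity {K : Type u} [Field K]
    {n : ℕ} (σ : absoluteGaloisGroup K) (ζ : rootsOfUnity n (AlgebraicClosure K)) :
    ((σ • ζ : rootsOfUnity n (AlgebraicClosure K)) : (AlgebraicClosure K)ˣ) =
      σ • (ζ : (AlgebraicClosure K)ˣ) := rfl

namespace DiscreteGaloisModule

section Units

variable (K : Type u) [Field K]

/-- The carrier `Additive K̄ˣ` of the discrete Galois module `K̄ˣ`, as an H21 type synonym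
carrying the **discrete** topology. A synonym is used (rather than a global topology instance
on `(AlgebraicClosure K)ˣ`) because Mathlib already topologises `AlgebraicClosure ℚ_[p]`
(`PadicAlgCl p`, a normed field, `Mathlib/NumberTheory/Padics/Complex.lean`) and hence its
units, non-discretely; a global instance would create a diamond.
Ref: Serre, *Galois Cohomology* (1997), Ch. II §1.1 (`K̄ˣ` as a discrete `Γ_K`-module). [folklore] -/
def UnitsCarrier : Type u := Additive (AlgebraicClosure K)ˣ

/-- `Additive K̄ˣ` is an abelian group. [folklore] -/
instance UnitsCarrier.instAddCommGroup : AddCommGroup (UnitsCarrier K) :=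
  inferInstanceAs <| AddCommGroup (Additive (AlgebraicClosure K)ˣ)

/-- The discrete topology on the carrier of the Galois module `K̄ˣ`. [folklore] -/
instance UnitsCarrier.instTopologicalSpace : TopologicalSpace (UnitsCarrier K) := ⊥

/-- The topology on `UnitsCarrier K` is discrete by definition. [folklore] -/
instance UnitsCarrier.instDiscreteTopology : DiscreteTopology (UnitsCarrier K) := ⟨rfl⟩

variable {K} in
/-- The identification `UnitsCarrier K ≃+ Additive K̄ˣ` (the identity). [folklore] -/
def UnitsCarrier.toAdditive : UnitsCarrier K ≃+ Additive (AlgebraicClosure K)ˣ :=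
  AddEquiv.refl _

variable {K} in
/-- View a unit of `K̄` as an element of the carrier of the Galois module `K̄ˣ`. [folklore] -/
def UnitsCarrier.ofUnits (u : (AlgebraicClosure K)ˣ) : UnitsCarrier K := Additive.ofMul u

/-- The discrete Galois module `K̄ˣ` (written additively, carrier `UnitsCarrier K =
Additive K̄ˣ`), with `Γ_K` acting through its action on `K̄`
(Mathlib `Representation.ofMulDistribMulAction`). Continuity: the stabiliser of `u` contains
`Gal(K̄/K(u))` (`Literature.NumberTheory.GaloisRepresentations.setOf_smul_eq_mem_nhds_one`).
Ref: Serre, *Galois Cohomology* (1997), Ch. II §1.2 (Hilbert's Theorem 90). [folklore] -/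
def units : DiscreteGaloisModule K (UnitsCarrier K) :=
  ContinuousRep.ofStabilizerMemNhdsOne (M := UnitsCarrier K)
    (Representation.ofMulDistribMulAction (absoluteGaloisGroup K) (AlgebraicClosure K)ˣ)
    fun u => by
      refine Filter.mem_of_superset
        (setOf_smul_eq_mem_nhds_one K ((UnitsCarrier.toAdditive u).toMul : AlgebraicClosure K))
        fun σ hσ => ?_
      simp only [Set.mem_setOf_eq] at hσ ⊢
      change Additive.ofMul (σ • Additive.toMul u) = Additive.ofMul (Additive.toMul u)
      refine congrArg Additive.ofMul (Units.ext ?_)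
      rw [Units.coe_smul]
      exact hσ

/-- Unfolding lemma for the module `K̄ˣ`. [folklore] -/
@[simp] lemma units_apply_apply (σ : absoluteGaloisGroup K) (u : UnitsCarrier K) :
    UnitsCarrier.toAdditive (units K σ u) =
      Additive.ofMul (σ • (UnitsCarrier.toAdditive u).toMul) := rfl

/-- The carrier `Additive (rootsOfUnity n K̄)` of the discrete Galois module `μₙ`, as an H21
type synonym carrying the **discrete** topology (see `UnitsCarrier` for why a synonym).
Ref: Serre, *Galois Cohomology* (1997), Ch. II §1.2. [folklore] -/
def MuCarrier (n : ℕ) : Type u := Additive (rootsOfUnity n (AlgebraicClosure K))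

/-- `Additive (rootsOfUnity n K̄)` is an abelian group. [folklore] -/
instance MuCarrier.instAddCommGroup (n : ℕ) : AddCommGroup (MuCarrier K n) :=
  inferInstanceAs <| AddCommGroup (Additive (rootsOfUnity n (AlgebraicClosure K)))

/-- The discrete topology on the carrier of the Galois module `μₙ`. [folklore] -/
instance MuCarrier.instTopologicalSpace (n : ℕ) : TopologicalSpace (MuCarrier K n) := ⊥

/-- The topology on `MuCarrier K n` is discrete by definition. [folklore] -/
instance MuCarrier.instDiscreteTopology (n : ℕ) : DiscreteTopology (MuCarrier K n) := ⟨rfl⟩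

variable {K} in
/-- The identification `MuCarrier K n ≃+ Additive (rootsOfUnity n K̄)` (the identity). [folklore] -/
def MuCarrier.toAdditive {n : ℕ} :
    MuCarrier K n ≃+ Additive (rootsOfUnity n (AlgebraicClosure K)) :=
  AddEquiv.refl _

variable {K} in
/-- View a root of unity in `K̄` as an element of the carrier of the Galois module `μₙ`. [folklore] -/
def MuCarrier.ofRootsOfUnity {n : ℕ} (ζ : rootsOfUnity n (AlgebraicClosure K)) :
    MuCarrier K n :=
  Additive.ofMul ζ

/-- The discrete Galois module `μₙ = μₙ(K̄)` of `n`-th roots of unity in `K̄` (written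
additively, carrier `MuCarrier K n = Additive (rootsOfUnity n K̄)`), a `Γ_K`-submodule of
`K̄ˣ`. When `n` is invertible in `K` (`[NeZero (n : K)]`, assumed in the statements using `μₙ`,
not needed for the definition) it is cyclic of order `n` (`HasEnoughRootsOfUnity`). Junk value:
for `n = 0` Mathlib's `rootsOfUnity 0 K̄` is all of `K̄ˣ`, so `mu K 0 = units K` as modules.
Continuity as for `units`.
Ref: Serre, *Galois Cohomology* (1997), Ch. II §1.2; Milne, *Arithmetic Duality Theorems*,
Ch. I §0. [folklore] -/
def mu (n : ℕ) : DiscreteGaloisModule K (MuCarrier K n) :=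
  ContinuousRep.ofStabilizerMemNhdsOne (M := MuCarrier K n)
    (Representation.ofMulDistribMulAction (absoluteGaloisGroup K)
      (rootsOfUnity n (AlgebraicClosure K)))
    fun ζ => by
      refine Filter.mem_of_superset
        (setOf_smul_eq_mem_nhds_one K
          (((MuCarrier.toAdditive ζ).toMul : (AlgebraicClosure K)ˣ) : AlgebraicClosure K))
        fun σ hσ => ?_
      simp only [Set.mem_setOf_eq] at hσ ⊢
      change Additive.ofMul (σ • Additive.toMul ζ) = Additive.ofMul (Additive.toMul ζ)
      refine congrArg Additive.ofMul (Subtype.ext (Units.ext ?_))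
      rw [absoluteGaloisGroup.coe_smul_rootsOfUnity, Units.coe_smul]
      exact hσ

/-- Unfolding lemma for the module `μₙ`. [folklore] -/
@[simp] lemma mu_apply_apply (n : ℕ) (σ : absoluteGaloisGroup K) (ζ : MuCarrier K n) :
    MuCarrier.toAdditive (mu K n σ ζ) =
      Additive.ofMul (σ • (MuCarrier.toAdditive ζ).toMul) := rfl

end Units

section Torsion

variable {K : Type u} [Field K] {M : Type w} [AddCommGroup M] [TopologicalSpace M]
  [DiscreteTopology M]

/-- The `n`-torsion `M[n]` of a discrete Galois module, as a discrete Galois module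
(the `Γ_K`-stable submodule `Submodule.torsionBy ℤ M n`, subspace = discrete topology).
Ref: Serre, *Galois Cohomology* (1997), Ch. I §2.1; Milne, *Arithmetic Duality Theorems*,
Ch. I §0 (notation `M[n]`, `M(ℓ)`). [folklore] -/
def torsionBy (ρ : DiscreteGaloisModule K M) (n : ℕ) :
    DiscreteGaloisModule K (Submodule.torsionBy ℤ M (n : ℤ)) :=
  ContinuousRep.subrepresentation ρ (Submodule.torsionBy ℤ M (n : ℤ)) fun g m hm => by
    simp only [Submodule.mem_comap, Submodule.mem_torsionBy_iff] at hm ⊢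
    rw [← LinearMap.map_smul, hm, map_zero]

/-- Unfolding lemma for `torsionBy`. [folklore] -/
@[simp] lemma torsionBy_apply_coe (ρ : DiscreteGaloisModule K M) (n : ℕ)
    (σ : absoluteGaloisGroup K) (m : Submodule.torsionBy ℤ M (n : ℤ)) :
    ((ρ.torsionBy n σ m : Submodule.torsionBy ℤ M (n : ℤ)) : M) = ρ σ m := rfl

end Torsion

end DiscreteGaloisModule

section TateTwist

/-- The reduction map `ℤ_[p] → ℤ/pⁿℤ` (`PadicInt.toZModPow`) is continuous for the discrete
topology on `ZMod (p ^ n)`: its kernel `pⁿℤ_[p]` (`PadicInt.ker_toZModPow`) is the closed ball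
of radius `p⁻ⁿ` (`PadicInt.norm_le_pow_iff_mem_span_pow`), a neighbourhood of `0`.
(Not in Mathlib in this form; named after the function, in the `Literature.PadicInt` namespace.)
Ref: Serre, *Local Fields*, Ch. II §1. [folklore] -/
theorem PadicInt.continuous_toZModPow (p : ℕ) [Fact p.Prime] (n : ℕ) :
    Continuous (PadicInt.toZModPow n : ℤ_[p] → ZMod (p ^ n)) := by
  refine continuous_of_continuousAt_zero (PadicInt.toZModPow n) ?_
  rw [ContinuousAt, map_zero, nhds_discrete (ZMod (p ^ n)), Filter.tendsto_pure]
  have hb : Metric.closedBall (0 : ℤ_[p]) ((p : ℝ) ^ (-n : ℤ)) ∈ 𝓝 (0 : ℤ_[p]) :=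
    Metric.closedBall_mem_nhds _ (zpow_pos (by exact_mod_cast (Fact.out : p.Prime).pos) _)
  filter_upwards [hb] with x hx
  rw [Metric.mem_closedBall, dist_zero_right, PadicInt.norm_le_pow_iff_mem_span_pow,
    ← PadicInt.ker_toZModPow, RingHom.mem_ker] at hx
  exact hx

variable (K : Type u) [Field K] (ℓ : ℕ) [Fact ℓ.Prime] (n : ℕ)

/-- The **mod `ℓⁿ` cyclotomic character** `Γ_K → (ℤ/ℓⁿℤ)`, `σ ↦ χ_ℓ(σ) mod ℓⁿ`: the `ℓ`-adic
cyclotomic character `GaloisRep.cyclotomicCharacter K ℓ` (item `GaloisRep`) reduced by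
`PadicInt.toZModPow n`. When `ℓ` is invertible in `K` (`[NeZero (ℓ : K)]`, so that `K̄` has
enough `ℓ`-power roots of unity), for `t ∈ K̄` with `t ^ ℓ ^ n = 1` one has
`σ • t = t ^ (cyclotomicCharacterModPow K ℓ n σ).val` (`GaloisRep.cyclotomicCharacter_spec`),
and `cyclotomicCharacterModPow K ℓ n σ = (modularCyclotomicCharacter K̄ _ σ).val` by Mathlib's
comparison `cyclotomicCharacter.toZModPow` with `modularCyclotomicCharacter`
(`Mathlib/NumberTheory/Cyclotomic/CyclotomicCharacter.lean`); so this is a composite of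
Mathlib pieces, not a rival definition. Without `[NeZero (ℓ : K)]` it is the trivial character
(junk value inherited from Mathlib's `cyclotomicCharacter`).
Ref: Serre, *Abelian ℓ-adic representations* (1968), Ch. I §1.2. [folklore] -/
def cyclotomicCharacterModPow : absoluteGaloisGroup K →* ZMod (ℓ ^ n) :=
  ((PadicInt.toZModPow n : ℤ_[ℓ] →+* ZMod (ℓ ^ n)).toMonoidHom.comp (Units.coeHom ℤ_[ℓ])).comp
    (GaloisRep.cyclotomicCharacter K ℓ).toMonoidHom

/-- Unfolding lemma for `cyclotomicCharacterModPow`. [folklore] -/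
lemma cyclotomicCharacterModPow_apply (σ : absoluteGaloisGroup K) :
    cyclotomicCharacterModPow K ℓ n σ =
      PadicInt.toZModPow n ((GaloisRep.cyclotomicCharacter K ℓ σ : ℤ_[ℓ]ˣ) : ℤ_[ℓ]) := rfl

/-- The mod `ℓⁿ` cyclotomic character is continuous (i.e. locally constant), from continuity of
`χ_ℓ` and `PadicInt.continuous_toZModPow`. Ref: Serre, *Abelian ℓ-adic representations*, Ch. I §1.2. [folklore] -/
theorem continuous_cyclotomicCharacterModPow : Continuous (cyclotomicCharacterModPow K ℓ n) :=
  (PadicInt.continuous_toZModPow ℓ n).comp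
    (Units.continuous_val.comp (GaloisRep.cyclotomicCharacter K ℓ).continuous)

variable {K} {M : Type w} [AddCommGroup M] [TopologicalSpace M] [DiscreteTopology M]
  [Module (ZMod (ℓ ^ n)) M]

/-- The underlying representation of the Tate twist: `σ ↦ χ_ℓ(σ) • ρ σ` on an
`ℓⁿ`-torsion module (`[Module (ZMod (ℓ ^ n)) M]`).
Ref: Serre, *Galois Cohomology* (1997), Ch. II §1 (Tate twists `M(1) = M ⊗ μ`). [folklore] -/
def DiscreteGaloisModule.tateTwistRepresentation (ρ : DiscreteGaloisModule K M) :
    Representation ℤ (absoluteGaloisGroup K) M where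
  toFun σ :=
    ((DistribSMul.toAddMonoidHom M (cyclotomicCharacterModPow K ℓ n σ)).comp
      (ρ σ).toAddMonoidHom).toIntLinearMap
  map_one' := by
    ext m
    simp
  map_mul' σ τ := by
    ext m
    simp [ZMod.map_smul, smul_smul, mul_comm]

/-- Unfolding lemma for `tateTwistRepresentation`. [folklore] -/
@[simp] lemma DiscreteGaloisModule.tateTwistRepresentation_apply_apply
    (ρ : DiscreteGaloisModule K M) (σ : absoluteGaloisGroup K) (m : M) :
    ρ.tateTwistRepresentation ℓ n σ m = cyclotomicCharacterModPow K ℓ n σ • ρ σ m := rfl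

/-- The **Tate twist** `M(1)` of an `ℓⁿ`-torsion discrete Galois module `M`
(`[Module (ZMod (ℓ ^ n)) M]`): the same group with `σ` acting by `χ_ℓ(σ) · ρ(σ)`, `χ_ℓ` the
`ℓ`-adic cyclotomic character reduced mod `ℓⁿ` (`cyclotomicCharacterModPow`). For
`ℓ ≠ char K` this is isomorphic to `M ⊗ μ_{ℓⁿ}`. Continuity: the stabiliser of `m` contains
`Stab_ρ(m) ∩ ker (χ_ℓ mod ℓⁿ)`, both open.
Ref: Serre, *Galois Cohomology* (1997), Ch. II §1; Milne, *Arithmetic Duality Theorems*,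
Ch. I §0 (notation `M(1)`). [folklore] -/
def DiscreteGaloisModule.tateTwist (ρ : DiscreteGaloisModule K M) : DiscreteGaloisModule K M :=
  ContinuousRep.ofStabilizerMemNhdsOne (ρ.tateTwistRepresentation ℓ n) fun m => by
    have h1 : {σ : absoluteGaloisGroup K | cyclotomicCharacterModPow K ℓ n σ = 1} ∈
        𝓝 (1 : absoluteGaloisGroup K) :=
      ((isOpen_discrete ({1} : Set (ZMod (ℓ ^ n)))).preimage
        (continuous_cyclotomicCharacterModPow K ℓ n)).mem_nhds (by simp)
    filter_upwards [h1, ρ.setOf_apply_eq_mem_nhds_one m] with σ hσ hσ'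
    rw [DiscreteGaloisModule.tateTwistRepresentation_apply_apply, hσ, one_smul, hσ']

/-- Unfolding lemma for the Tate twist. [folklore] -/
@[simp] lemma DiscreteGaloisModule.tateTwist_apply_apply (ρ : DiscreteGaloisModule K M)
    (σ : absoluteGaloisGroup K) (m : M) :
    ρ.tateTwist ℓ n σ m = cyclotomicCharacterModPow K ℓ n σ • ρ σ m := rfl

end TateTwist

/-! ### Inflation -/

section Inflation

variable {K : Type u} [Field K]

namespace DiscreteGaloisModule

variable {M : Type w} [AddCommGroup M] [TopologicalSpace M] [DiscreteTopology M]

/-- For a normal subgroup `S ⊴ Γ_K`, the invariants `M^S` as a discrete module over the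
topological quotient group `Γ_K ⧸ S` (Mathlib `Representation.toInvariants`,
`Representation.ofQuotient`). Continuity: the stabiliser of `w` in `Γ_K ⧸ S` is the image of
its (open) stabiliser in `Γ_K` under the open map `Γ_K → Γ_K ⧸ S`.
Ref: Serre, *Galois Cohomology* (1997), Ch. I §2.6 (the module `A^H` over `G/H`). [folklore] -/
def quotientInvariants (ρ : DiscreteGaloisModule K M) (S : Subgroup (absoluteGaloisGroup K))
    [S.Normal] :
    ContinuousRep (absoluteGaloisGroup K ⧸ S) ℤ
      (Representation.invariants (ρ.toRepresentation.comp S.subtype)) :=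
  ContinuousRep.ofStabilizerMemNhdsOne
    (Representation.ofQuotient (ρ.toRepresentation.toInvariants S) S) fun w => by
      have h := (QuotientGroup.isOpenMap_coe (N := S)).image_mem_nhds
        ((ContinuousRep.subrepresentation ρ _
          (Representation.le_comap_invariants ρ.toRepresentation S)).setOf_apply_eq_mem_nhds_one
          w)
      refine Filter.mem_of_superset h ?_
      rintro _ ⟨σ, hσ, rfl⟩
      exact hσ

/-- Unfolding lemma for `quotientInvariants` on classes of elements of `Γ_K`. [folklore] -/
@[simp] lemma quotientInvariants_apply_coe (ρ : DiscreteGaloisModule K M)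
    (S : Subgroup (absoluteGaloisGroup K)) [S.Normal] (σ : absoluteGaloisGroup K)
    (w : Representation.invariants (ρ.toRepresentation.comp S.subtype)) :
    ((ρ.quotientInvariants S (σ : absoluteGaloisGroup K ⧸ S) w :
      Representation.invariants (ρ.toRepresentation.comp S.subtype)) : M) = ρ σ w := rfl

end DiscreteGaloisModule

variable {M : Type u} [AddCommGroup M] [TopologicalSpace M] [DiscreteTopology M]

/-- The continuous quotient homomorphism `G →ₜ* G ⧸ N` of a topological group by a normal
subgroup (Mathlib `QuotientGroup.mk'` bundled with `QuotientGroup.continuous_mk`; Mathlib has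
no bundled `ContinuousMonoidHom` version). Placed in the `Literature.ContinuousMonoidHom` namespace.
Ref: Bourbaki, *Topologie Générale*, Ch. III §2.6. [folklore] -/
@[to_additive ContinuousAddMonoidHom.quotientMk /-- The continuous quotient homomorphism `G →ₜ+ G ⧸ N` of a topological additive
group by a normal subgroup (Mathlib `QuotientAddGroup.mk'`, `QuotientAddGroup.continuous_mk`).
Ref: Bourbaki, *Topologie Générale*, Ch. III §2.6. [folklore] -/]
def ContinuousMonoidHom.quotientMk {G : Type*} [Group G] [TopologicalSpace G] (N : Subgroup G)
    [N.Normal] : G →ₜ* G ⧸ N :=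
  ⟨QuotientGroup.mk' N, QuotientGroup.continuous_mk⟩

/-- Unfolding lemma for `ContinuousMonoidHom.quotientMk`. [folklore] -/
@[to_additive (attr := simp) ContinuousAddMonoidHom.quotientMk_apply /-- Unfolding lemma for `ContinuousAddMonoidHom.quotientMk`. [folklore] -/]
lemma ContinuousMonoidHom.quotientMk_apply {G : Type*} [Group G] [TopologicalSpace G]
    (N : Subgroup G) [N.Normal] (g : G) :
    ContinuousMonoidHom.quotientMk N g = (g : G ⧸ N) := rfl

/-- The **inflation map** `inf : Hⁿ(Γ_K ⧸ S, M^S) →+ Hⁿ(K, M)` for a normal subgroup `S ⊴ Γ_K`: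
pull back along `Γ_K → Γ_K ⧸ S` (`ContinuousMonoidHom.quotientMk`) and push forward along the
inclusion `M^S ⊆ M` (Mathlib `ContinuousCohomology.map`). The source is written as the raw
carrier of Mathlib's `continuousCohomology n (ρ.quotientInvariants S).toTopRep : TopModuleCat ℤ`
(with its `AddCommGroup` structure from the `TopModuleCat` coercion), not as a
`galoisCohomology`, because `Γ_K ⧸ S` is not literally an absolute Galois group.
Ref: Serre, *Galois Cohomology* (1997), Ch. I §2.6; Neukirch–Schmidt–Wingberg (1.5.1). [folklore] -/
def galoisCohomology.inf (ρ : DiscreteGaloisModule K M) (S : Subgroup (absoluteGaloisGroup K))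
    [S.Normal] (n : ℕ) :
    (continuousCohomology n (ρ.quotientInvariants S).toTopRep : TopModuleCat ℤ) →+
      galoisCohomology ρ n :=
  (ContinuousCohomology.map (ContinuousMonoidHom.quotientMk S)
    (X := (ρ.quotientInvariants S).toTopRep) (Y := ρ.toTopRep)
    (TopRep.ofHom ⟨Submodule.subtypeL _, fun _ => rfl⟩) n).hom.toLinearMap.toAddMonoidHom

/-- The closed normal subgroup `Gal(K̄/E) ⊴ Γ_K` attached to a normal subextension
`E ⊆ K̄` of `K`: the kernel of the (surjective) restriction `Γ_K → Gal(E/K)`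
(`AlgEquiv.restrictNormalHom`), equal to `E.fixingSubgroup`
(`IntermediateField.restrictNormalHom_ker`). Being a kernel it is normal by instance.
Ref: Neukirch, *Algebraic Number Theory*, Ch. IV §1. [folklore] -/
abbrev absGaloisFixingSubgroup (E : IntermediateField K (AlgebraicClosure K)) [Normal K E] :
    Subgroup (absoluteGaloisGroup K) :=
  ((AlgEquiv.restrictNormalHom (F := K) (K₁ := AlgebraicClosure K) E).comp
    (absoluteGaloisGroup.toAlgEquiv K).toMonoidHom).ker

/-- Membership in `absGaloisFixingSubgroup E`: `σ` fixes `E` pointwise. [folklore] -/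
lemma mem_absGaloisFixingSubgroup_iff (E : IntermediateField K (AlgebraicClosure K)) [Normal K E]
    (σ : absoluteGaloisGroup K) :
    σ ∈ absGaloisFixingSubgroup E ↔ ∀ x ∈ E, σ • x = x := by
  rw [absGaloisFixingSubgroup, MonoidHom.mem_ker, MonoidHom.comp_apply, ← MonoidHom.mem_ker,
    IntermediateField.restrictNormalHom_ker, IntermediateField.mem_fixingSubgroup_iff]
  rfl

end Inflation

/-! ### The main statements (named facts `def X : Prop`, `K`/`M` explicit; take `(h : X K M)`) -/

section Theorems

variable (K : Type u) [Field K]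

/-- **Hilbert's Theorem 90**: `H¹(K, K̄ˣ) = 0`.
Ref: Serre, *Local Fields*, Ch. X §1, Prop. 2 (`H¹(G(L/K), Lˣ) = 0` for every Galois `L/K`,
finite or infinite); Serre, *Galois Cohomology* (1997), Ch. II §1.2 (stated there for
`H¹(K, K_sˣ)`).  The fact is about `K̄ˣ = (AlgebraicClosure K)ˣ`: for perfect `K` this is
`K_sˣ`; for imperfect `K` of characteristic `p`, `K̄ˣ = ⋃ₘ (K_s^{p^{-m}})ˣ` with each term
`Γ_K`-isomorphic to `K_sˣ` via `x ↦ x^{p^m}`, and `H¹` commutes with direct limits (Serre,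
*Galois Cohomology*, Ch. I §2.2, Prop. 8), so the two vanishing statements agree.  (Mathlib has
the finite case `H¹(Gal(L/K), Lˣ) = 0` as
`groupCohomology.isMulCoboundary₁_of_isMulCocycle₁_of_aut_to_units` and
`groupCohomology.H1ofAutOnUnitsUnique` in
`RepresentationTheory/Homological/GroupCohomology/Hilbert90.lean`, for discrete group
cohomology; the profinite statement is the direct limit of these.) [cite: Serre1979, Ch. X §1, Prop. 2] -/
def subsingleton_galoisCohomology_units_one : Prop :=
  Subsingleton (galoisCohomology (DiscreteGaloisModule.units K) 1)

/-- **Kummer theory**: for `n` invertible in `K`, the Kummer sequence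
`1 → μₙ → K̄ˣ →ⁿ K̄ˣ → 1` and Hilbert 90 give `H¹(K, μₙ) ≃ Kˣ/(Kˣ)ⁿ`. The right-hand side
`Kˣ ⧸ (powMonoidHom n).range` is literally the group `K/n` of
`Mathlib/RingTheory/DedekindDomain/SelmerGroup.lean`, whose subgroup
`IsDedekindDomain.selmerGroup` `K⟮S, n⟯` thus becomes a subgroup of `H¹(K, μₙ)`
(classes unramified outside `S`).  Only the existence of *some* isomorphism is asserted; the
canonical Kummer coboundary `δ : Kˣ/(Kˣ)ⁿ → H¹(K, μₙ)` is not singled out (a statement needing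
the canonical map cannot use this fact).
Ref: Serre, *Galois Cohomology* (1997), Ch. II §1.2; Milne, *Arithmetic Duality Theorems*,
Ch. I, Example 0.9. [cite: Serre1997, Ch. II §1.2] -/
def nonempty_addEquiv_galoisCohomology_mu_one : Prop :=
  ∀ (n : ℕ) [NeZero (n : K)],
    Nonempty (galoisCohomology (DiscreteGaloisModule.mu K n) 1 ≃+
      Additive (Kˣ ⧸ (powMonoidHom n : Kˣ →* Kˣ).range))

-- `K` and `M` explicit: consumers of the three facts below write `(h : exact_inf_res K M)`.
variable (M : Type u) [AddCommGroup M] [TopologicalSpace M] [DiscreteTopology M]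

/-- Injectivity of inflation in degree one: `H¹(Γ_K ⧸ S, M^S) → H¹(K, M)` is injective for
every closed normal subgroup `S ⊴ Γ_K` (first map of the inflation–restriction sequence), as
printed.  (It also holds for non-closed `S`, since `M^S = M^{cl S}` — stabilisers are open — and
continuous cochains on `Γ_K ⧸ S` with discrete values factor through `Γ_K ⧸ cl S`; that
reduction is not vendored.)
Ref: Serre, *Galois Cohomology* (1997), Ch. I §2.6(b); Neukirch–Schmidt–Wingberg (1.6.7). [cite: NeukirchSchmidtWingberg2008, (1.6.7)] -/
def galoisCohomology.inf_one_injective : Prop :=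
  ∀ (ρ : DiscreteGaloisModule K M) (S : Subgroup (absoluteGaloisGroup K)) [S.Normal],
    IsClosed (S : Set (absoluteGaloisGroup K)) → Function.Injective (galoisCohomology.inf ρ S 1)

/-- `H¹(K, M)` is the union of the inflations from its finite Galois quotients: every class in
`H¹(K, M)` is the inflation of a class in `H¹(Γ_K ⧸ Γ_E, M^{Γ_E})` for some finite Galois
subextension `E/K` of `K̄/K` (`Γ_E = absGaloisFixingSubgroup E`, and
`Γ_K ⧸ Γ_E ≃ Gal(E/K)` is finite discrete, so the source is ordinary group cohomology,
Mathlib's `groupCohomology.H1`). Equivalently `H¹(K, M) = lim→ H¹(Gal(E/K), M^{Gal(K̄/E)})`.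
Ref: Serre, *Galois Cohomology* (1997), Ch. I §2.2, Cor. 1 to Prop. 8; Neukirch–Schmidt–
Wingberg, *Cohomology of Number Fields*, (1.2.5). [cite: NeukirchSchmidtWingberg2008, (1.2.5)] -/
def galoisCohomology.exists_inf_eq_one : Prop :=
  ∀ (ρ : DiscreteGaloisModule K M) (x : galoisCohomology ρ 1),
    ∃ (E : IntermediateField K (AlgebraicClosure K)) (_ : FiniteDimensional K E)
      (_ : IsGalois K E) (y : (continuousCohomology 1
        (ρ.quotientInvariants (absGaloisFixingSubgroup E)).toTopRep : TopModuleCat ℤ)),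
      galoisCohomology.inf ρ (absGaloisFixingSubgroup E) 1 y = x

/-- **Inflation–restriction** in degree one for a normal subextension `E/K` of `K̄/K`:
the sequence `0 → H¹(Γ_K ⧸ Γ_E, M^{Γ_E}) →(inf) H¹(K, M) →(res) H¹(E, M)` is exact at
`H¹(K, M)`, where `Γ_E = absGaloisFixingSubgroup E = Gal(K̄/E)` and `res` is restriction along
`absGaloisRestrict K E : Γ_E → Γ_K` (whose image is `Gal(K̄/E)` since `E/K` is normal).
Ref: Serre, *Galois Cohomology* (1997), Ch. I §2.6(b); Neukirch–Schmidt–Wingberg,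
*Cohomology of Number Fields*, (1.6.7). [cite: NeukirchSchmidtWingberg2008, (1.6.7)] -/
def exact_inf_res : Prop :=
  ∀ (ρ : DiscreteGaloisModule K M) (E : IntermediateField K (AlgebraicClosure K)) [Normal K E],
    Function.Exact (galoisCohomology.inf ρ (absGaloisFixingSubgroup E) 1)
      (galoisCohomology.res ρ E 1)

/-- Sanity check: the facts take the field and the coefficient module explicitly. -/
example (h : exact_inf_res K M) (ρ : DiscreteGaloisModule K M)
    (E : IntermediateField K (AlgebraicClosure K)) [Normal K E] :
    Function.Exact (galoisCohomology.inf ρ (absGaloisFixingSubgroup E) 1)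
      (galoisCohomology.res ρ E 1) :=
  h ρ E

end Theorems

end Literature.NumberTheory.GaloisRepresentations
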